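import Summits.BirchSwinnertonDyer.BirchSwinnertonDyer.Theorems.ByReductionTypeAtTwoRankOneAtTwoBigImageOddLocalFklLevelOne
import Literature.NumberTheory.EllipticCurves.CuspFormLFunctionLevelConductorProofs
import HarnessLib

/-!
# Line `fkl` of crux `RankOneAtTwoBigImageOddLocal` (stmt-BirchSwinnertonDyer-23715, route ByReductionTypeAtTwo):
# K2-A1 `PrimeLevelDictionary` is a THEOREM, and the level-one layer of K2-F is K2-A's `κ_ℓ`

Lead prover seat `bsd-line-fkl-p1` (g0), helpers `--supports stmt-BirchSwinnertonDyer-23715` (registered stub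
`stub_katoFirstLayerLaw : F1Sign2.FirstLayerLawAtTwo`); sequel to `…FklLevelOne` (p592555).

1. `primeLevelDictionary_holds : F1Sign2.PrimeLevelDictionary` — the tree's `@[conjecture]` K2-A1
   (`F1Sign2/KuriharaStructureAtTwo.lean` §2, «targets; provable from `[r+1]⁺ = [r]⁺`, the Hecke relation and `[−r]⁺ = [r]⁺`»)
   is now PROVED: for the newform `f` of `W` (any level `N`) and a prime `ℓ ∤ 2N`,
   `2·κ_ℓ(f) = (a_ℓ − 2)·[0]⁺_f − T_ℓ(f)` and `T_ℓ(f) = 0` if `ℓ ≡ 3 (mod 4)`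
   (`κ_ℓ = kuriharaSumTwo f ℓ`, `T_ℓ = twistSymbolSum f ℓ = ∑_{a mod ℓ} (a/ℓ)[a/ℓ]⁺_f`).  Inputs, all PROVED in the tree:
   `heckeSumAtPrimeLevel_holds`, `ratPlusSymbol_add_intCast_holds`, `ratPlusSymbol_neg`,
   `IsNewformOf.dvd_level_iff_dvd_conductorNorm` (level and conductor have the same primes), Mathlib's Jacobi-symbol API.
2. `cast_val_toAdd_eq_jacobi`: a surjective `ψ : (ℤ/ℓ)ˣ → ℤ/2` (`ℓ` odd prime) IS the quadratic character, `ψ = (1 − (·/ℓ))/2`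
   (cyclicity of `(ℤ/ℓ)ˣ`); hence `levelSumTwo_one_eq_two_mul_kuriharaSumTwo`: K2-F's level-one Kurihara number
   `δ'_1(ℓ; ψ)` is K2-A's `2κ_ℓ(f)`, and `levelSumTwo_one_eq_neg_twistSymbolSum`: in positive analytic rank
   `δ'_1(ℓ; ψ) = −T_ℓ(f)` at every prime `ℓ ∤ 2N_W`.
3. `firstLayerLawAtTwo_a_levelOne_iff_twistSymbolSum`: on a curve of analytic rank one, for every `τ`-prime `ℓ`, every
   surjective `ψ` and every parameter `s`, the conclusion of K2-F (a) at `(ℓ, k = 1)` is EQUIVALENT to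
   `T_ℓ(f) ∈ 2ℤ_{(2)}` — «the quadratic-twist symbol sum `T_ℓ(f) = L(E^{(ℓ)},1)/Ω(E^{(ℓ)})` (signed Birch formula, `ℓ ≡ 1 (4)`)
   is EVEN».  At `ℓ ≡ 3 (mod 4)` this holds because `T_ℓ = 0` (item 1; = `…FklLevelOne`); at `ℓ ≡ 1 (mod 4)` it is the
   BSD₂-predicted divisibility by the Tamagawa factor `c_ℓ(E^{(ℓ)}) = #Ẽ(𝔽_ℓ)[2] = 2` of the twist — the exact printed-open
   content of the level-one layer (census of the lead: no symbol-level proof; Agashe–Ribet–Stein-type Tamagawa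
   divisibilities of `L^{alg}` are printed away from `2`).
Theorems only; no `def`, no named-fact hypothesis, no `sorry`.  BSD is not proved by any of this.
-/

set_option autoImplicit false

noncomputable section

open scoped Classical MatrixGroups ModularForm

set_option linter.dupNamespace false

namespace Summit.BirchSwinnertonDyer.BirchSwinnertonDyer.Theorems.RankOneAtTwoFkl

open CongruenceSubgroup WeierstrassCurve Literature.NumberTheory.EllipticCurves
  Literature.NumberTheory.EllipticCurves.ModularForms Summit.BirchSwinnertonDyer.Rank1Residual.F1Sign2

/-! ## Reindexing sums over `ℤ/ℓ` -/

/-- A sum over `ZMod (k+1) = Fin (k+1)` of a function of the representative `val` is the sum over `range (k+1)`. [folklore] -/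
theorem sum_zmod_succ_val_eq_sum_range {M : Type*} [AddCommMonoid M] (k : ℕ) (g : ℕ → M) :
    ∑ a : ZMod (k + 1), g a.val = ∑ i ∈ Finset.range (k + 1), g i :=
  Fin.sum_univ_eq_sum_range g (k + 1)

/-- `∑_{x ∈ ℤ/ℓ} G(x) = G(0) + ∑_{w ∈ (ℤ/ℓ)ˣ} G(w)` for a prime `ℓ` (the units are the non-zero classes). [folklore] -/
theorem sum_univ_zmod_eq_zero_add_sum_units {ℓ : ℕ} [Fact ℓ.Prime] {M : Type*} [AddCommMonoid M]
    (G : ZMod ℓ → M) : ∑ x : ZMod ℓ, G x = G 0 + ∑ w : (ZMod ℓ)ˣ, G w := by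
  have h1 : ∑ w : (ZMod ℓ)ˣ, G w = ∑ x : {x : ZMod ℓ // x ≠ 0}, G x :=
    Fintype.sum_equiv (unitsEquivNeZero (G₀ := ZMod ℓ)) (fun w : (ZMod ℓ)ˣ => G (w : ZMod ℓ))
      (fun x : {x : ZMod ℓ // x ≠ 0} => G (x : ZMod ℓ)) (fun w => rfl)
  have h2 : ∑ x : {x : ZMod ℓ // x ≠ 0}, G x = ∑ x ∈ (Finset.univ : Finset (ZMod ℓ)).erase 0, G x :=
    (Finset.sum_subtype ((Finset.univ : Finset (ZMod ℓ)).erase 0) (p := fun x => x ≠ 0)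
      (by intro x; simp [Finset.mem_erase]) G).symm
  rw [h1, h2, Finset.add_sum_erase _ _ (Finset.mem_univ (0 : ZMod ℓ))]

/-- **The quadratic-twist symbol sum over units**: `T_ℓ(f) = ∑_{u ∈ (ℤ/ℓ)ˣ} (u/ℓ)·[u/ℓ]⁺_f` for a prime `ℓ` (the
defining sum of `twistSymbolSum` runs over the representatives `a = 0, …, ℓ`; the two end terms have Jacobi symbol `0`).
[folklore] -/
theorem twistSymbolSum_eq_sum_units {M : ℕ} (f : CuspForm (Gamma0 M) 2) (ℓ : ℕ) [Fact ℓ.Prime] :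
    twistSymbolSum f ℓ =
      ∑ u : (ZMod ℓ)ˣ, (jacobiSym (((u : ZMod ℓ).val : ℤ)) ℓ : ℚ) *
        ratPlusSymbol f ((((u : ZMod ℓ).val : ℚ)) / ℓ) := by
  have hℓ : ℓ.Prime := Fact.out
  obtain ⟨k, hk⟩ := Nat.exists_eq_add_one_of_ne_zero hℓ.ne_zero
  subst hk
  let g : ℕ → ℚ := fun i => (jacobiSym (i : ℤ) (k + 1) : ℚ) * ratPlusSymbol f ((i : ℚ) / (k + 1 : ℕ))
  have hT : twistSymbolSum f (k + 1) = ∑ a : ZMod (k + 1 + 1), g a.val := by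
    unfold twistSymbolSum
    rfl
  rw [hT, sum_zmod_succ_val_eq_sum_range (k + 1) g, Finset.sum_range_succ]
  have hlast : g (k + 1) = 0 := by
    simp only [g]
    rw [jacobiSym.mod_left]
    have : ((k + 1 : ℕ) : ℤ) % ((k + 1 : ℕ) : ℤ) = 0 := Int.emod_self
    push_cast at this ⊢
    rw [this, jacobiSym.zero_left hℓ.one_lt]
    simp
  rw [hlast, add_zero, ← sum_zmod_succ_val_eq_sum_range k g,
    sum_univ_zmod_eq_zero_add_sum_units (fun x : ZMod (k + 1) => g x.val)]
  have h0 : g (0 : ZMod (k + 1)).val = 0 := by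
    simp only [g, ZMod.val_zero, Nat.cast_zero, jacobiSym.zero_left hℓ.one_lt]
    simp
  rw [h0, zero_add]

/-- **`2κ_ℓ(f) = ∑_u [u/ℓ]⁺_f − ∑_u (u/ℓ)[u/ℓ]⁺_f`** at a prime `ℓ` (unfolding `kuriharaSumTwo`: one prime factor, weight
`(1 − (u/ℓ))/2`). [folklore] -/
theorem two_mul_kuriharaSumTwo_prime {M : ℕ} (f : CuspForm (Gamma0 M) 2) (ℓ : ℕ) [Fact ℓ.Prime] :
    2 * kuriharaSumTwo f ℓ =
      (∑ u : (ZMod ℓ)ˣ, ratPlusSymbol f ((((u : ZMod ℓ).val : ℚ)) / ℓ)) -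
        ∑ u : (ZMod ℓ)ˣ, (jacobiSym (((u : ZMod ℓ).val : ℤ)) ℓ : ℚ) *
          ratPlusSymbol f ((((u : ZMod ℓ).val : ℚ)) / ℓ) := by
  have hℓ : ℓ.Prime := Fact.out
  unfold kuriharaSumTwo
  rw [Nat.Prime.primeFactors hℓ, Finset.mul_sum, ← Finset.sum_sub_distrib]
  refine Finset.sum_congr rfl fun u _ => ?_
  rw [Finset.prod_singleton]
  ring

/-- `[(−u)/ℓ]⁺_f = [u/ℓ]⁺_f` for a unit `u` mod a prime `ℓ` (representatives: `(ℓ − a)/ℓ = −a/ℓ + 1`; the tree's PROVED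
periodicity `ratPlusSymbol_add_intCast_holds` and evenness `ratPlusSymbol_neg`). [folklore] -/
theorem ratPlusSymbol_neg_unit {M : ℕ} [NeZero M] (f : CuspForm (Gamma0 M) 2) {ℓ : ℕ} [Fact ℓ.Prime]
    (u : (ZMod ℓ)ˣ) :
    ratPlusSymbol f (((((-u : (ZMod ℓ)ˣ) : ZMod ℓ).val : ℚ)) / ℓ) =
      ratPlusSymbol f ((((u : ZMod ℓ).val : ℚ)) / ℓ) := by
  have hu : (u : ZMod ℓ) ≠ 0 := u.ne_zero
  have hval : ((-u : (ZMod ℓ)ˣ) : ZMod ℓ).val = ℓ - (u : ZMod ℓ).val := by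
    rw [Units.val_neg, ZMod.neg_val, if_neg hu]
  have hle : (u : ZMod ℓ).val ≤ ℓ := (ZMod.val_lt _).le
  rw [hval, Nat.cast_sub hle]
  have : (((ℓ : ℚ) - ((u : ZMod ℓ).val : ℚ)) / ℓ) = -((((u : ZMod ℓ).val : ℚ)) / ℓ) + (1 : ℤ) := by
    have hℓ0 : (ℓ : ℚ) ≠ 0 := by exact_mod_cast (Fact.out : ℓ.Prime).ne_zero
    push_cast; field_simp; ring
  rw [this, ratPlusSymbol_add_intCast_holds (f := f), ratPlusSymbol_neg]

/-- `((−u)/ℓ) = −(u/ℓ)` for `ℓ ≡ 3 (mod 4)` (`(−1/ℓ) = χ₄(ℓ) = −1`; Mathlib `jacobiSym.neg`, `ZMod.χ₄_nat_three_mod_four`).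
[folklore] -/
theorem jacobiSym_neg_unit_val {ℓ : ℕ} [Fact ℓ.Prime] (hℓ4 : ℓ % 4 = 3) (u : (ZMod ℓ)ˣ) :
    jacobiSym ((((-u : (ZMod ℓ)ˣ) : ZMod ℓ).val : ℤ)) ℓ = - jacobiSym (((u : ZMod ℓ).val : ℤ)) ℓ := by
  have hu : (u : ZMod ℓ) ≠ 0 := u.ne_zero
  have hval : ((-u : (ZMod ℓ)ˣ) : ZMod ℓ).val = ℓ - (u : ZMod ℓ).val := by
    rw [Units.val_neg, ZMod.neg_val, if_neg hu]
  have hle : (u : ZMod ℓ).val ≤ ℓ := (ZMod.val_lt _).le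
  rw [hval, Nat.cast_sub hle, jacobiSym.mod_left]
  have hmod : ((ℓ : ℤ) - ((u : ZMod ℓ).val : ℤ)) % (ℓ : ℤ) = (-(((u : ZMod ℓ).val : ℤ))) % (ℓ : ℤ) := by
    rw [show (ℓ : ℤ) - ((u : ZMod ℓ).val : ℤ) = -(((u : ZMod ℓ).val : ℤ)) + 1 * (ℓ : ℤ) by ring,
      Int.add_mul_emod_self_right]
  rw [hmod, ← jacobiSym.mod_left, jacobiSym.neg _ (Nat.odd_iff.mpr (by omega)),
    ZMod.χ₄_nat_three_mod_four hℓ4]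
  ring

/-- **`T_ℓ(f) = 0` for every prime `ℓ ≡ 3 (mod 4)`** (any cusp form `f` of level `M ≥ 1`): the odd character `(·/ℓ)` against
the even, `ℓ`-periodic symbol `[·/ℓ]⁺` — the involution `u ↦ −u` changes the sign of every term. [folklore] -/
theorem twistSymbolSum_eq_zero_of_mod_four_eq_three {M : ℕ} [NeZero M] (f : CuspForm (Gamma0 M) 2)
    (ℓ : ℕ) [Fact ℓ.Prime] (hℓ4 : ℓ % 4 = 3) : twistSymbolSum f ℓ = 0 := by
  rw [twistSymbolSum_eq_sum_units]
  set T := ∑ u : (ZMod ℓ)ˣ, (jacobiSym (((u : ZMod ℓ).val : ℤ)) ℓ : ℚ) *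
    ratPlusSymbol f ((((u : ZMod ℓ).val : ℚ)) / ℓ) with hT
  have hneg : T = -T := by
    conv_lhs => rw [hT, ← Equiv.sum_comp (Equiv.neg (ZMod ℓ)ˣ)]
    rw [hT, ← Finset.sum_neg_distrib]
    refine Finset.sum_congr rfl fun u _ => ?_
    rw [Equiv.neg_apply, ratPlusSymbol_neg_unit, jacobiSym_neg_unit_val hℓ4]
    push_cast
    ring
  linarith

/-- **K2-A1 — the prime-level dictionary `F1Sign2.PrimeLevelDictionary` is a THEOREM.**  For the newform `f` of an
elliptic `W/ℚ` at any level `N` and a prime `ℓ ∤ 2N`: `2·κ_ℓ(f) = (a_ℓ(W) − 2)·[0]⁺_f − T_ℓ(f)`, and `T_ℓ(f) = 0` when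
`ℓ ≡ 3 (mod 4)`.  Proof: `two_mul_kuriharaSumTwo_prime`, the Hecke sum `∑_u [u/ℓ]⁺ = (a_ℓ − 2)[0]⁺`
(`heckeSumAtPrimeLevel_holds`; `ℓ ∤ N_W` because the level and the conductor have the same prime divisors,
`IsNewformOf.dvd_level_iff_dvd_conductorNorm`), `twistSymbolSum_eq_sum_units`, `twistSymbolSum_eq_zero_of_mod_four_eq_three`.
[cite: MazurTateTeitelbaum1986Invent, §I.4 (4.2) and §I.8] -/
theorem primeLevelDictionary_holds : PrimeLevelDictionary := by
  intro W _ _ N _ f hf ℓ _ hℓ2N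
  have hℓ : ℓ.Prime := Fact.out
  have hℓN : ¬ ℓ ∣ N := fun h => hℓ2N (dvd_mul_of_dvd_right h 2)
  have hℓNW : ¬ ℓ ∣ W.conductorNorm ℤ := fun h => hℓN ((hf.dvd_level_iff_dvd_conductorNorm hℓ).mpr h)
  have hN : Nat.Coprime (W.conductorNorm ℤ) ℓ := ((Nat.Prime.coprime_iff_not_dvd hℓ).mpr hℓNW).symm
  refine ⟨?_, fun h4 => twistSymbolSum_eq_zero_of_mod_four_eq_three f ℓ h4⟩
  rw [two_mul_kuriharaSumTwo_prime, heckeSumAtPrimeLevel_holds W f hf ℓ hN, twistSymbolSum_eq_sum_units]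

/-! ## A surjective `ψ : (ℤ/ℓ)ˣ → ℤ/2` is the quadratic character; K2-F's level one is K2-A's `κ_ℓ` -/

/-- The Jacobi symbol `(u/ℓ)` of the representative of a unit `u` mod a prime `ℓ` is the quadratic character of `u`
(`legendreSym ℓ a = quadraticChar (ℤ/ℓ) a`). [folklore] -/
theorem jacobiSym_val_eq_quadraticChar {ℓ : ℕ} [Fact ℓ.Prime] (u : (ZMod ℓ)ˣ) :
    jacobiSym (((u : ZMod ℓ).val : ℤ)) ℓ = quadraticChar (ZMod ℓ) (u : ZMod ℓ) := by
  rw [← jacobiSym.legendreSym.to_jacobiSym, legendreSym]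
  congr 1
  push_cast
  exact ZMod.natCast_zmod_val _

/-- **A surjective `ψ : (ℤ/ℓ)ˣ → ℤ/2` IS the quadratic character** (`ℓ` prime; for `ℓ = 2` there is no such `ψ`): lifted to `{0, 1}`,
`ψ(u) = (1 − (u/ℓ))/2`.  `(ℤ/ℓ)ˣ` is cyclic; a generator `g` has `ψ(g) = 1 (mod 2)` (else `ψ` is trivial) and is a
non-residue (else `g = y²` and again `ψ(g) = ψ(y)² = 0`); then `u = gⁿ` gives `ψ(u) = n mod 2` and `(u/ℓ) = (−1)ⁿ`. [folklore] -/
theorem cast_val_toAdd_eq_jacobi {ℓ : ℕ} [Fact ℓ.Prime]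
    (ψ : (ZMod ℓ)ˣ →* Multiplicative (ZMod (2 ^ 1))) (hψ : Function.Surjective ψ) (u : (ZMod ℓ)ˣ) :
    ((Multiplicative.toAdd (ψ u)).val : ℚ) = (1 - (jacobiSym (((u : ZMod ℓ).val : ℤ)) ℓ : ℚ)) / 2 := by
  obtain ⟨g, hg⟩ := IsCyclic.exists_generator (α := (ZMod ℓ)ˣ)
  have hgen : ∀ x : (ZMod ℓ)ˣ, ∃ n : ℕ, g ^ n = x := fun x =>
    (Submonoid.mem_powers_iff _ _).mp (mem_powers_iff_mem_zpowers.mpr (hg x))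
  have htwo : ∀ x : Multiplicative (ZMod (2 ^ 1)), x = 1 ∨ x = Multiplicative.ofAdd 1 := by decide
  have hsq1 : ∀ x : Multiplicative (ZMod (2 ^ 1)), x ^ 2 = 1 := by decide
  -- `ψ g = ofAdd 1`
  have hψg : ψ g = Multiplicative.ofAdd 1 := by
    rcases htwo (ψ g) with h | h
    · exfalso
      obtain ⟨x, hx⟩ := hψ (Multiplicative.ofAdd 1)
      obtain ⟨n, rfl⟩ := hgen x
      rw [map_pow, h, one_pow] at hx
      exact absurd hx (by decide)
    · exact h
  -- `g` is a non-residue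
  have hg0 : (g : ZMod ℓ) ≠ 0 := g.ne_zero
  have hqg : quadraticChar (ZMod ℓ) (g : ZMod ℓ) = -1 := by
    rcases quadraticChar_dichotomy hg0 with h | h
    · exfalso
      obtain ⟨y, hy⟩ := (quadraticChar_one_iff_isSquare hg0).mp h
      have hy0 : y ≠ 0 := by
        intro h0; rw [h0, mul_zero] at hy; exact hg0 hy
      let y' : (ZMod ℓ)ˣ := Units.mk0 y hy0
      have hgy : g = y' ^ 2 := Units.ext (by rw [Units.val_pow_eq_pow_val, Units.val_mk0, sq]; exact hy)
      have : ψ g = 1 := by rw [hgy, map_pow, hsq1]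
      rw [hψg] at this
      exact absurd this (by decide)
    · exact h
  -- `u = g ^ n`: both sides are `n mod 2`
  obtain ⟨n, rfl⟩ := hgen u
  rw [jacobiSym_val_eq_quadraticChar, Units.val_pow_eq_pow_val, map_pow (quadraticChar (ZMod ℓ)), hqg,
    map_pow ψ, hψg]
  have hval : (Multiplicative.toAdd (Multiplicative.ofAdd (1 : ZMod (2 ^ 1)) ^ n)).val = n % 2 := by
    rw [← ofAdd_nsmul, toAdd_ofAdd, nsmul_one, ZMod.val_natCast, pow_one]
  rw [hval]
  rcases Nat.even_or_odd n with he | ho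
  · rw [he.neg_one_pow, Nat.even_iff.mp he]; norm_num
  · rw [ho.neg_one_pow, Nat.odd_iff.mp ho]; norm_num

/-- **K2-F's level-one Kurihara number is K2-A's `2κ_ℓ`**: `δ'_1(ℓ; ψ) = 2·κ_ℓ(f)` for a prime `ℓ`, any cusp form `f`
and any surjective `ψ : (ℤ/ℓ)ˣ → ℤ/2^1` (`cast_val_toAdd_eq_jacobi` termwise). [folklore] -/
theorem levelSumTwo_one_eq_two_mul_kuriharaSumTwo {M : ℕ} (f : CuspForm (Gamma0 M) 2) {ℓ : ℕ}
    [Fact ℓ.Prime] (ψ : (ZMod ℓ)ˣ →* Multiplicative (ZMod (2 ^ 1)))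
    (hψ : Function.Surjective ψ) : levelSumTwo f ℓ 1 ψ = 2 * kuriharaSumTwo f ℓ := by
  have hℓ : ℓ.Prime := Fact.out
  unfold levelSumTwo kuriharaSumTwo
  rw [Nat.Prime.primeFactors hℓ, Finset.mul_sum]
  refine Finset.sum_congr rfl fun u _ => ?_
  rw [Finset.prod_singleton, cast_val_toAdd_eq_jacobi ψ hψ u]
  ring

/-- **In positive analytic rank `δ'_1(ℓ; ψ) = −T_ℓ(f)`** for the newform `f` of `W`, every prime `ℓ ∤ 2N_W` and every
surjective `ψ`: the dictionary (`primeLevelDictionary_holds`, through the level: `ℓ ∤ 2M`) with `[0]⁺_f = 0`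
(`ratPlusSymbol_zero_eq_zero_of_analyticRank_ne_zero`, `…FklLevelOne`). [cite: MazurTateTeitelbaum1986Invent, §I.8] -/
theorem levelSumTwo_one_eq_neg_twistSymbolSum (W : WeierstrassCurve ℚ) [W.IsElliptic] [W.IsGloballyMinimal]
    {M : ℕ} [NeZero M] (f : CuspForm (Gamma0 M) 2) (hf : IsNewformOf W f) (hr : W.analyticRank ≠ 0)
    {ℓ : ℕ} [Fact ℓ.Prime] (hℓ2 : ℓ ≠ 2) (hN : ¬ ℓ ∣ W.conductorNorm ℤ)
    (ψ : (ZMod ℓ)ˣ →* Multiplicative (ZMod (2 ^ 1))) (hψ : Function.Surjective ψ) :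
    levelSumTwo f ℓ 1 ψ = - twistSymbolSum f ℓ := by
  have hℓ : ℓ.Prime := Fact.out
  have hℓM : ¬ ℓ ∣ 2 * M := by
    intro h
    rcases (Nat.Prime.dvd_mul hℓ).mp h with h2 | hM
    · exact hℓ2 ((Nat.prime_dvd_prime_iff_eq hℓ Nat.prime_two).mp h2)
    · exact hN ((hf.dvd_level_iff_dvd_conductorNorm hℓ).mp hM)
  rw [levelSumTwo_one_eq_two_mul_kuriharaSumTwo f ψ hψ, (primeLevelDictionary_holds W f hf ℓ hℓM).1,
    ratPlusSymbol_zero_eq_zero_of_analyticRank_ne_zero W f hf hr, mul_zero, zero_sub]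

/-- `x ∈ 2^k ℤ_{(2)} ↔ −x ∈ 2^k ℤ_{(2)}`. [folklore] -/
theorem inTwoPowZLoc_neg_iff (k : ℕ) (x : ℚ) : InTwoPowZLoc k (-x) ↔ InTwoPowZLoc k x := by
  constructor
  · rintro ⟨q, hq, hd⟩
    exact ⟨-q, by linarith, by rwa [Rat.neg_den]⟩
  · rintro ⟨q, hq, hd⟩
    exact ⟨-q, by rw [hq]; ring, by rwa [Rat.neg_den]⟩

/-- **The level-one layer of K2-F (a) is the PARITY OF THE QUADRATIC-TWIST SYMBOL SUM.**  For `W/ℚ` globally minimal of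
analytic rank one (the slice of crux `RankOneAtTwoBigImageOddLocal`), `f` its newform at any level, a `τ`-prime `ℓ`
(`IsLevelAtTwo W ℓ`, so `ℓ ∤ 2N_W`), a surjective `ψ : (ℤ/ℓ)ˣ → ℤ/2^1` and ANY parameter `s`:
the conclusion `δ'_1(ℓ; ψ) ∈ 2^{min(1, s+1)} ℤ_{(2)}` of `F1Sign2.FirstLayerLawAtTwo` (a) at `(ℓ, 1)` holds
**iff `T_ℓ(f) ∈ 2ℤ_{(2)}`**.  For `ℓ ≡ 3 (mod 4)` the right side holds (`T_ℓ = 0`, `primeLevelDictionary_holds`); for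
`ℓ ≡ 1 (mod 4)`, where `T_ℓ(f) = L(E^{(ℓ)}, 1)/Ω(E^{(ℓ)})` by the signed Birch formula, it says that the algebraic `L`-value
of the quadratic twist by the `τ`-prime `ℓ` is EVEN — the Tamagawa factor `c_ℓ(E^{(ℓ)}) = 2` of BSD₂, open in print.
[conjecture] corner made explicit, kernel theorem. -/
theorem firstLayerLawAtTwo_a_levelOne_iff_twistSymbolSum (W : WeierstrassCurve ℚ) [W.IsElliptic]
    [W.IsGloballyMinimal] {M : ℕ} [NeZero M] (f : CuspForm (Gamma0 M) 2) (hf : IsNewformOf W f)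
    (han : W.analyticRank = 1) (s : ℕ) (ℓ : ℕ) [Fact ℓ.Prime] (hlev : IsLevelAtTwo W ℓ)
    (ψ : (ZMod ℓ)ˣ →* Multiplicative (ZMod (2 ^ 1))) (hψ : Function.Surjective ψ) :
    InTwoPowZLoc (min 1 (s + 1)) (levelSumTwo f ℓ 1 ψ) ↔ InTwoPowZLoc 1 (twistSymbolSum f ℓ) := by
  have hℓ : ℓ.Prime := Fact.out
  have h2N : ¬ ℓ ∣ 2 * W.conductorNorm ℤ := (hlev.2 ℓ (dvd_refl ℓ)).1
  have hℓ2 : ℓ ≠ 2 := by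
    rintro rfl
    exact h2N (dvd_mul_right 2 _)
  have hN : ¬ ℓ ∣ W.conductorNorm ℤ := fun h => h2N (dvd_mul_of_dvd_right h 2)
  have hmin : min 1 (s + 1) = 1 := by omega
  rw [hmin, levelSumTwo_one_eq_neg_twistSymbolSum W f hf (by rw [han]; exact one_ne_zero) hℓ2 hN ψ hψ,
    inTwoPowZLoc_neg_iff]

end Summit.BirchSwinnertonDyer.BirchSwinnertonDyer.Theorems.RankOneAtTwoFkl

end
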